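import Mathlib
import Literature.Computability.AlgebraicComplexity.ArithCircuitProofs
import Summits.ValiantsHypothesis.ValiantsHypothesis.Theorems.DivisionGapTriangularDimersDivisionEasyOddJoinDefs

/-!
# Crux `DivisionGap.TriangularDimersDivisionEasy` (stmt-ValiantsHypothesis-5067), line `Sketch` —
registered stub `stub_substIdentity`

The SUBSTITUTION IDENTITY of the odd-join face lift: the monotone chart map `substY n`
(`x_e ↦ y_e` and `x_(e.swap) ↦ 1 + y_e` for the forward edges `e` of the rhombus `R_n`, where
`y_e = x_e · x_(e.swap)`; identity on non-edge variables) carries the split odd-join polynomial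
`oddJoinSplit n = Σ_{J odd} Π_{e ∈ J} x_e · Π_{e ∈ E ∖ J} x_(e.swap)` to the odd-join polynomial
`oddJoin n = Σ_{J odd} Π_{e ∈ J} y_e · Π_{e ∈ E ∖ J} (1 + y_e)`, and every substituted polynomial
`substY n e` is computed by a monotone fan-in-two circuit with at most two gates.

## Proof

* A forward pair `e` (every member of `edges n`, hence every member of an odd cover `J ⊆ edges n`
  and of `edges n ∖ J`) has `substY n e = y_e`; its reversal `e.swap` is not forward (coordinates,
  `omega`) while `e.swap.swap = e` is, so `substY n e.swap = 1 + y_e`.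
* `aeval (substY n)` is an `ℝ≥0`-algebra map: it commutes with the sum over `oddCovers n` and with
  both products (`map_sum`, `map_mul`, `map_prod`) and sends `X e` to `substY n e` (`aeval_X`);
  `Finset.prod_congr` with the first bullet turns each summand into the corresponding summand of
  `oddJoin n`.
* Cost: constants and variables are free and each gate adds one (`complexity_C`, `complexity_X`,
  `complexity_add_le`, `complexity_mul_le` of `ArithCircuit(Proofs)`), so `y_e = x_e · x_(e.swap)`
  costs `≤ 1`, `1 + y_e` costs `≤ 2`, and a bare variable costs `0`.
-/

-- `Summit.ValiantsHypothesis.ValiantsHypothesis.…` is the tree's mandated single-conjunct layout (Sub = Summit).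
set_option linter.dupNamespace false

namespace Summit.ValiantsHypothesis.ValiantsHypothesis.Theorems.TriangularDimersDivisionEasy.OddJoin

open scoped BigOperators NNReal
open Finset MvPolynomial Literature.Computability.AlgebraicComplexity

noncomputable section

namespace SubstIdentity
/-! ### Helper lemmas for `stub_substIdentity` (this stub's private namespace) -/

variable {n : ℕ}

/-! #### The chart map on edges and their reversals -/

/-- The reversal of a forward pair is not forward. [folklore] -/
theorem not_isFwd_swap {e : Var n} (h : IsFwd e) : ¬ IsFwd e.swap := by
  intro h'
  simp only [IsFwd, Prod.fst_swap, Prod.snd_swap] at h h'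
  omega

/-- Members of `edges n` are forward pairs. [folklore] -/
theorem isFwd_of_mem_edges {e : Var n} (h : e ∈ edges n) : IsFwd e := by
  rw [edges, mem_filter] at h
  exact h.2

/-- An odd cover is a set of edges. [folklore] -/
theorem subset_edges_of_mem_oddCovers {J : Finset (Var n)} (hJ : J ∈ oddCovers n) :
    J ⊆ edges n := by
  rw [oddCovers, mem_filter, mem_powerset] at hJ
  exact hJ.1

/-- On a forward pair the chart map is `y_e`. [folklore] -/
theorem substY_of_isFwd {e : Var n} (h : IsFwd e) : substY n e = yv e := by
  rw [substY, if_pos h]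

/-- On the reversal of a forward pair the chart map is `1 + y_e`. [folklore] -/
theorem substY_swap_of_isFwd {e : Var n} (h : IsFwd e) : substY n e.swap = 1 + yv e := by
  rw [substY, if_neg (not_isFwd_swap h), Prod.swap_swap, if_pos h]

/-! #### Gate counts -/

/-- The doubled edge variable `y_e = x_e · x_(e.swap)` costs at most one gate. [folklore] -/
theorem complexity_yv_le (e : Var n) : complexity (yv e) ≤ 1 := by
  unfold yv
  refine (complexity_mul_le_holds _ _).trans ?_
  rw [complexity_X_holds, complexity_X_holds]

/-- `1 + y_e` costs at most two gates. [folklore] -/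
theorem complexity_one_add_yv_le (e : Var n) : complexity (1 + yv e) ≤ 2 := by
  refine (complexity_add_le_holds _ _).trans ?_
  have h1 : complexity (1 : MvPolynomial (Var n) ℝ≥0) = 0 := by
    simpa using complexity_C_holds (σ := Var n) (1 : ℝ≥0)
  have h2 := complexity_yv_le e
  omega

/-! #### The two halves -/

/-- The identity half: `aeval (substY n)` carries `oddJoinSplit n` to `oddJoin n`. [folklore] -/
theorem aeval_substY_oddJoinSplit (n : ℕ) : aeval (substY n) (oddJoinSplit n) = oddJoin n := by
  unfold oddJoinSplit oddJoin
  rw [map_sum]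
  refine sum_congr rfl fun J hJ => ?_
  have hJE : J ⊆ edges n := subset_edges_of_mem_oddCovers hJ
  rw [map_mul, map_prod, map_prod]
  congr 1
  · refine prod_congr rfl fun e he => ?_
    rw [aeval_X, substY_of_isFwd (isFwd_of_mem_edges (hJE he))]
  · refine prod_congr rfl fun e he => ?_
    rw [aeval_X, substY_swap_of_isFwd (isFwd_of_mem_edges (sdiff_subset he))]

/-- The cost half: every `substY n e` costs at most two gates. [folklore] -/
theorem complexity_substY_le (n : ℕ) (e : Var n) : complexity (substY n e) ≤ 2 := by
  unfold substY
  split_ifs with h₁ h₂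
  · exact (complexity_yv_le e).trans one_le_two
  · exact complexity_one_add_yv_le e.swap
  · rw [complexity_X_holds]
    exact Nat.zero_le _

end SubstIdentity

/-- STUB `stub_substIdentity` of the line `Sketch` — the SUBSTITUTION IDENTITY: the monotone chart
map `substY n` carries the split odd-join polynomial `oddJoinSplit n` to the odd-join polynomial
`oddJoin n`, and each substituted polynomial `substY n e` costs at most two gates. [folklore] -/
theorem stub_substIdentity (n : ℕ) :
    aeval (substY n) (oddJoinSplit n) = oddJoin n ∧ ∀ e : Var n, complexity (substY n e) ≤ 2 :=
  ⟨SubstIdentity.aeval_substY_oddJoinSplit n, SubstIdentity.complexity_substY_le n⟩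

end

end Summit.ValiantsHypothesis.ValiantsHypothesis.Theorems.TriangularDimersDivisionEasy.OddJoin
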